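import Summits.AnomalousDissipation.AnomalousDissipation.Theorems.SawtoothPulseCascadeK1LocalisedCascadeCornerTraceShift
import Summits.AnomalousDissipation.AnomalousDissipation.Theorems.SawtoothPulseCascadeK1LocalisedCascadeHalfStepVO

/-!
# K1loc, line `Spectral` — helper: THE CORNER-TRACE HALF-STEP, ONE FIBRE (S-D, arbiter A23-12 (iv)(a) / A23-13 (2))

The circle-level core of the corner-trace (CT) grade of the half-step.  On one fibre the tracked part of the input is a
trigonometric polynomial `T = Σ_{l∈S} c_l e_l`, multiplied by the ROUNDED chirp `g` (the twist); `g₀` is the EXACT chirp, for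
which `…CornerTraceSum.cornerTrace_sum_sq_le` bounds `Σ_{k∈W}|Σ_l c_l ĝ₀(k − l)|² ≤ X`.  If `|g − g₀| ≤ η` off a measurable
zone set `B` and `≤ 2` everywhere, then (Minkowski + Bessel)
  `Σ_{k∈W} |𝓕(g·T)(k)|² ≤ (√X + √(η²(Σ_l|c_l|²) + 4∫_B |T|²))²`
(`sum_window_sq_norm_fourierCoeff_mul_trigPoly_le`).  Tools: Bessel in integral form for a continuous circle function,
Parseval for `Σ c_l e_l`, and the evaluation `Σ c_l e_l(↑y) = Σ c_l e^{2πily}`.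
-/

-- `Summit.<Summit>.<Problem>`: single-conjunct summit, the duplicate namespace segment is deliberate.
set_option linter.dupNamespace false

namespace Summit.AnomalousDissipation.AnomalousDissipation.Theorems.SawtoothPulseCascade.K1Window

open MeasureTheory Set Filter Topology Function Complex AddCircle
open scoped Real
open Literature.Analysis Literature.Analysis.FunctionSpaces Literature.Analysis.FunctionSpaces.Torus

/-- **Bessel, integral form**: for a continuous circle function `h` and a finite set of modes `S`,
`Σ_{q∈S} |ĥ(q)|² ≤ ∫ |h|²`. [cite: Grafakos2014, Prop. 3.2.7 (3)] -/
theorem sum_sq_norm_fourierCoeff_le_integral {h : UnitAddCircle → ℂ} (hc : Continuous h) (S : Finset ℤ) :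
    ∑ q ∈ S, ‖fourierCoeff h q‖ ^ 2 ≤ ∫ t : UnitAddCircle, ‖h t‖ ^ 2 := by
  obtain ⟨B, hB⟩ := (isCompact_univ.image hc).isBounded.exists_norm_le
  have hB' : ∀ x, ‖h x‖ ≤ B := fun x => hB _ ⟨x, mem_univ _, rfl⟩
  have hmem : MemLp h 2 haarAddCircle :=
    (memLp_top_of_bound hc.aestronglyMeasurable B (Eventually.of_forall hB')).mono_exponent le_top
  have hP := hasSum_sq_fourierCoeff (hmem.toLp _)
  have hcoe : ∀ p, fourierCoeff (hmem.toLp _) p = fourierCoeff h p := fun p => by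
    simp only [fourierCoeff]
    exact integral_congr_ae (by filter_upwards [MemLp.coeFn_toLp hmem] with x hx; simp only [hx])
  simp_rw [hcoe] at hP
  have h1 : ∫ t, ‖(hmem.toLp _) t‖ ^ 2 ∂haarAddCircle = ∫ t : UnitAddCircle, ‖h t‖ ^ 2 := by
    rw [volume_unitAddCircle_eq_haar]
    exact integral_congr_ae (by filter_upwards [MemLp.coeFn_toLp hmem] with t ht; rw [ht])
  exact (sum_le_hasSum S (fun q _ => sq_nonneg _) hP).trans h1.le

/-- **Parseval for a trigonometric polynomial `Σ_{l∈S} c_l e_l`**: `∫|Σ c_l e_l|² = Σ|c_l|²`. [cite: Grafakos2014, Prop. 3.2.7 (3)] -/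
theorem integral_norm_sq_trigPolyPos (S : Finset ℤ) (c : ℤ → ℂ) :
    ∫ s : UnitAddCircle, ‖∑ l ∈ S, c l * fourier l s‖ ^ 2 = ∑ l ∈ S, ‖c l‖ ^ 2 := by
  classical
  have e : ∀ s : UnitAddCircle, ∑ m ∈ S.image Neg.neg, c (-m) * (fourier (-m) s : ℂ) = ∑ l ∈ S, c l * fourier l s :=
    fun s => by rw [Finset.sum_image fun a _ b _ h => neg_injective h]; simp only [neg_neg]
  have e2 : ∑ m ∈ S.image Neg.neg, ‖c (-m)‖ ^ 2 = ∑ l ∈ S, ‖c l‖ ^ 2 := by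
    rw [Finset.sum_image fun a _ b _ h => neg_injective h]; simp only [neg_neg]
  have h := integral_norm_sq_trigPoly (S.image Neg.neg) (fun m => c (-m))
  simp only [e, e2] at h
  exact h

/-- Evaluation of a trigonometric polynomial at a real point: `Σ c_l e_l(↑y) = Σ c_l e^{2πily}`. [folklore] -/
theorem trigPolyPos_coe_apply (S : Finset ℤ) (c : ℤ → ℂ) (y : ℝ) :
    ∑ l ∈ S, c l * (fourier l ((y : ℝ) : UnitAddCircle) : ℂ) = ∑ l ∈ S, c l * cexp (2 * π * I * l * y) := by
  refine Finset.sum_congr rfl fun l _ => ?_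
  rw [fourier_coe_apply]
  congr 1
  congr 1
  push_cast; ring

/-- **THE CT HALF-STEP ON ONE FIBRE (perturbation form).**  `g, g₀` continuous on the circle, `T = Σ_{l∈S} c_l e_l`, a window
`W ⊂ ℤ` with the exact-chirp corner-trace bound `Σ_{k∈W}|Σ_l c_l ĝ₀(k−l)|² ≤ X`, and `|g − g₀| ≤ η` off a measurable set `B`,
`|g − g₀| ≤ 2` everywhere.  Then `Σ_{k∈W}|𝓕(gT)(k)|² ≤ (√X + √(η² Σ|c_l|² + 4∫_B|T|²))²` (coefficient split
`𝓕(gT) = Σ c_l ĝ₀(k−l) + 𝓕((g−g₀)T)`, Minkowski, Bessel, pointwise bound). [cite: Grafakos2014, Prop. 3.2.7 (3), Prop. 3.1.2 (5)] -/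
theorem sum_window_sq_norm_fourierCoeff_mul_trigPoly_le {g g₀ : UnitAddCircle → ℂ} (hg : Continuous g)
    (hg₀ : Continuous g₀) (c : ℤ → ℂ) (S W : Finset ℤ) {X η : ℝ}
    (hX : ∑ k ∈ W, ‖∑ l ∈ S, c l * fourierCoeff g₀ (k - l)‖ ^ 2 ≤ X)
    {B : Set UnitAddCircle} (hBm : MeasurableSet B) (hoff : ∀ x, x ∉ B → ‖g x - g₀ x‖ ≤ η)
    (hon : ∀ x, ‖g x - g₀ x‖ ≤ 2) :
    ∑ k ∈ W, ‖fourierCoeff (fun x : UnitAddCircle => g x * ∑ l ∈ S, c l * fourier l x) k‖ ^ 2 ≤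
      (Real.sqrt X + Real.sqrt (η ^ 2 * (∑ l ∈ S, ‖c l‖ ^ 2) +
        4 * ∫ x in B, ‖∑ l ∈ S, c l * (fourier l x : ℂ)‖ ^ 2)) ^ 2 := by
  classical
  set T : UnitAddCircle → ℂ := fun x => ∑ l ∈ S, c l * fourier l x with hT
  have hTc : Continuous T := continuous_finsetSum _ fun l _ => continuous_const.mul (fourier l).continuous
  set h : UnitAddCircle → ℂ := fun x => g x - g₀ x with hh
  have hhc : Continuous h := hg.sub hg₀
  have hI : ∀ {f : UnitAddCircle → ℝ}, Continuous f → Integrable f := fun hf =>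
    hf.integrable_of_hasCompactSupport (HasCompactSupport.of_compactSpace _)
  -- the coefficient split
  have hsplit : ∀ k, fourierCoeff (fun x => g x * T x) k =
      ∑ l ∈ S, c l * fourierCoeff g₀ (k - l) + fourierCoeff (fun x => h x * T x) k := by
    intro k
    have e : (fun x => g x * T x) = fun x => g₀ x * T x + h x * T x := by
      funext x; simp only [hh]; ring
    rw [e, fourierCoeff_add_of_continuous (G := fun x => g₀ x * T x) (H := fun x => h x * T x) (hg₀.mul hTc) (hhc.mul hTc),
      fourierCoeff_mul_trigPoly hg₀ c S k]
  -- Minkowski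
  have hM : ∑ k ∈ W, ‖fourierCoeff (fun x => g x * T x) k‖ ^ 2 ≤
      (Real.sqrt (∑ k ∈ W, ‖∑ l ∈ S, c l * fourierCoeff g₀ (k - l)‖ ^ 2) +
        Real.sqrt (∑ k ∈ W, ‖fourierCoeff (fun x => h x * T x) k‖ ^ 2)) ^ 2 := by
    have h1 : ∑ k ∈ W, ‖fourierCoeff (fun x => g x * T x) k‖ ^ 2 ≤
        ∑ k ∈ W, (‖∑ l ∈ S, c l * fourierCoeff g₀ (k - l)‖ + ‖fourierCoeff (fun x => h x * T x) k‖) ^ 2 := by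
      refine Finset.sum_le_sum fun k _ => ?_
      rw [hsplit k]
      exact pow_le_pow_left₀ (norm_nonneg _) (norm_add_le _ _) 2
    have h2 := SpectralLeakage.sqrt_sum_add_sq_le W (a := fun k => ‖∑ l ∈ S, c l * fourierCoeff g₀ (k - l)‖)
      (b := fun k => ‖fourierCoeff (fun x => h x * T x) k‖) (fun k _ => norm_nonneg _) (fun k _ => norm_nonneg _)
    have h0 : 0 ≤ ∑ k ∈ W, (‖∑ l ∈ S, c l * fourierCoeff g₀ (k - l)‖ + ‖fourierCoeff (fun x => h x * T x) k‖) ^ 2 :=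
      Finset.sum_nonneg fun k _ => sq_nonneg _
    calc ∑ k ∈ W, ‖fourierCoeff (fun x => g x * T x) k‖ ^ 2
        ≤ _ := h1
      _ = (Real.sqrt (∑ k ∈ W, (‖∑ l ∈ S, c l * fourierCoeff g₀ (k - l)‖ +
            ‖fourierCoeff (fun x => h x * T x) k‖) ^ 2)) ^ 2 := (Real.sq_sqrt h0).symm
      _ ≤ _ := pow_le_pow_left₀ (Real.sqrt_nonneg _) h2 2
  -- the remainder: Bessel, then the pointwise bound `η` off `B`, `2` on `B`
  have hR : ∑ k ∈ W, ‖fourierCoeff (fun x => h x * T x) k‖ ^ 2 ≤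
      η ^ 2 * (∑ l ∈ S, ‖c l‖ ^ 2) + 4 * ∫ x in B, ‖T x‖ ^ 2 := by
    refine (sum_sq_norm_fourierCoeff_le_integral (hhc.mul hTc) W).trans ?_
    have hpt : ∀ x, ‖h x * T x‖ ^ 2 ≤ η ^ 2 * ‖T x‖ ^ 2 + 4 * B.indicator (fun x => ‖T x‖ ^ 2) x := by
      intro x
      rw [norm_mul, mul_pow]
      by_cases hx : x ∈ B
      · rw [indicator_of_mem hx]
        have h4 : ‖h x‖ ^ 2 ≤ 4 := by
          have := pow_le_pow_left₀ (norm_nonneg _) (hon x) 2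
          linarith
        have h5 : ‖h x‖ ^ 2 * ‖T x‖ ^ 2 ≤ 4 * ‖T x‖ ^ 2 := mul_le_mul_of_nonneg_right h4 (sq_nonneg _)
        have h6 : 0 ≤ η ^ 2 * ‖T x‖ ^ 2 := by positivity
        linarith
      · rw [indicator_of_notMem hx, mul_zero, add_zero]
        exact mul_le_mul_of_nonneg_right (pow_le_pow_left₀ (norm_nonneg _) (hoff x hx) 2) (sq_nonneg _)
    have hTn : Continuous fun x => ‖T x‖ ^ 2 := (continuous_norm.comp hTc).pow 2
    have hI1 : Integrable fun x => ‖h x * T x‖ ^ 2 := hI ((continuous_norm.comp (hhc.mul hTc)).pow 2)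
    have hI2 : Integrable fun x => η ^ 2 * ‖T x‖ ^ 2 := (hI hTn).const_mul _
    have hI3 : Integrable fun x => 4 * B.indicator (fun x => ‖T x‖ ^ 2) x := ((hI hTn).indicator hBm).const_mul _
    have hI23 : Integrable fun x => η ^ 2 * ‖T x‖ ^ 2 + 4 * B.indicator (fun x => ‖T x‖ ^ 2) x := hI2.add hI3
    calc ∫ x, ‖h x * T x‖ ^ 2 ≤ ∫ x, (η ^ 2 * ‖T x‖ ^ 2 + 4 * B.indicator (fun x => ‖T x‖ ^ 2) x) :=
          integral_mono_of_nonneg (Eventually.of_forall fun x => sq_nonneg _) hI23 (Eventually.of_forall hpt)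
      _ = η ^ 2 * (∫ x, ‖T x‖ ^ 2) + 4 * ∫ x in B, ‖T x‖ ^ 2 := by
          rw [integral_add hI2 hI3, integral_const_mul, integral_const_mul, integral_indicator hBm]
      _ = η ^ 2 * (∑ l ∈ S, ‖c l‖ ^ 2) + 4 * ∫ x in B, ‖T x‖ ^ 2 := by
          simp only [hT]; rw [integral_norm_sq_trigPolyPos S c]
  exact hM.trans (pow_le_pow_left₀ (by positivity) (add_le_add (Real.sqrt_le_sqrt hX) (Real.sqrt_le_sqrt hR)) 2)

end Summit.AnomalousDissipation.AnomalousDissipation.Theorems.SawtoothPulseCascade.K1Window
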